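import Mathlib.Geometry.Euclidean.Inversion.Basic
import Mathlib.Analysis.InnerProductSpace.Basic
import HarnessLib

/-!
# Images of balls under the unit inversion `x ↦ x/‖x‖²`

Topic `Literature/Geometry/Euclidean`.  For the inversion `EuclideanGeometry.inversion 0 1` of a real inner
product space (Mathlib `Mathlib/Geometry/Euclidean/Inversion/Basic.lean`, which has the definition, the
involution/injectivity and the distance formula `dist_inversion_inversion`, but not the action on spheres off
the centre) we prove the classical fact that a closed or open ball NOT containing the centre of inversion is
mapped onto a ball, with the explicit image datum: for `0 ≤ ρ < ‖c‖` and `s := ‖c‖² - ρ² > 0`,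

  `x/‖x‖² ∈ B̄(c/s, ρ/s) ↔ x ∈ B̄(c, ρ)`   (`inversion_mem_closedBall_iff`, all `x`), likewise for open balls,

hence `inv '' B̄(c,ρ) = B̄(c/s, ρ/s)`, `inv '' B(c,ρ) = B(c/s, ρ/s)` and disjointness is preserved.  Everything
rests on one algebraic identity (`norm_inversion_sub_sq_sub`):
`‖x/‖x‖² - c/s‖² - (ρ/s)² = (‖x - c‖² - ρ²)/(s‖x‖²)` for `x ≠ 0`.  The second part records the second-order
off-centring of the image of a small ball about a point `z ≠ 0` — the image of `B̄(z, η)` is the ball of radius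
`η/(‖z‖²-η²)` about `z/(‖z‖²-η²)`, at distance `η²/((‖z‖²-η²)‖z‖)` from `z/‖z‖²` (`dist_inversion_smul_self`) —
and the resulting sandwich of the ball `B(z/‖z‖², η/‖z‖²)` between the images of `B(z, η(1∓ε))` for
`η ≤ ε‖z‖/8` (`ball_inversion_subset_image`, `image_subset_ball_inversion`), which is what covariance
bookkeeping for inversions consumes (e.g. Camia–Feng, arXiv:2411.01467, §3.2.3: "the thinnest annulus that
contains the symmetric difference of `φ⁻¹(B_ε(φ(z_j)))` and `B_{ε/s_j}(z_j)`").

References: H. S. M. Coxeter, *Introduction to Geometry* (2nd ed., Wiley 1969), §6.1–6.3 (inversion in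
spheres maps spheres not through the centre to spheres); standard, tagged folklore below.
-/

noncomputable section

namespace Literature.Geometry.Euclidean

open EuclideanGeometry Metric

variable {V : Type*} [NormedAddCommGroup V] [InnerProductSpace ℝ V]

/-- The unit inversion at the origin is `x ↦ x/‖x‖²`. [folklore] -/
theorem inversion_zero_one_eq (x : V) : inversion (0:V) 1 x = (‖x‖ ^ 2)⁻¹ • x := by
  rw [inversion_def]
  simp only [dist_zero_right, vsub_eq_sub, sub_zero, vadd_eq_add, add_zero, one_div, inv_pow]

/-- `‖x/‖x‖²‖ = ‖x‖⁻¹`. [folklore] -/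
theorem norm_inversion_zero_one (x : V) : ‖inversion (0:V) 1 x‖ = ‖x‖⁻¹ := by
  have h := dist_inversion_center (0:V) x 1
  rw [dist_zero_right, dist_zero_right, one_pow, one_div] at h
  exact h

/-- The key identity behind "inversion maps spheres to spheres": for `x ≠ 0` and
`s := ‖c‖² - ρ² ≠ 0`, `‖x/‖x‖² - c/s‖² - (ρ/s)² = (‖x - c‖² - ρ²)/(s‖x‖²)`. [folklore] -/
theorem norm_inversion_sub_sq_sub (x c : V) (ρ : ℝ) (hx : x ≠ 0) (hs : ‖c‖ ^ 2 - ρ ^ 2 ≠ 0) :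
    ‖inversion (0:V) 1 x - (‖c‖ ^ 2 - ρ ^ 2)⁻¹ • c‖ ^ 2 - (ρ / (‖c‖ ^ 2 - ρ ^ 2)) ^ 2 =
      (‖x - c‖ ^ 2 - ρ ^ 2) / ((‖c‖ ^ 2 - ρ ^ 2) * ‖x‖ ^ 2) := by
  set s := ‖c‖ ^ 2 - ρ ^ 2 with hs_def
  have hx2 : ‖x‖ ^ 2 ≠ 0 := pow_ne_zero 2 (norm_ne_zero_iff.2 hx)
  rw [inversion_zero_one_eq, @norm_sub_sq_real, @norm_sub_sq_real, norm_smul, norm_smul,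
    real_inner_smul_left, real_inner_smul_right, Real.norm_eq_abs, Real.norm_eq_abs, mul_pow, mul_pow,
    sq_abs, sq_abs, real_inner_comm c x]
  have hc2 : ‖c‖ ^ 2 = s + ρ ^ 2 := by rw [hs_def]; ring
  rw [hc2]
  field_simp
  ring

omit [InnerProductSpace ℝ V] in
/-- If `0 ≤ ρ < ‖c‖` then `s = ‖c‖² - ρ² > 0`. [folklore] -/
theorem sub_sq_pos_of_lt_norm {c : V} {ρ : ℝ} (hρ : 0 ≤ ρ) (h : ρ < ‖c‖) : 0 < ‖c‖ ^ 2 - ρ ^ 2 := by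
  have : ρ ^ 2 < ‖c‖ ^ 2 := by gcongr
  linarith

omit [InnerProductSpace ℝ V] in
/-- A closed ball `B̄(c, ρ)` with `ρ < ‖c‖` avoids the origin. [folklore] -/
theorem zero_notMem_closedBall_of_lt_norm {c : V} {ρ : ℝ} (h : ρ < ‖c‖) : (0:V) ∉ closedBall c ρ := by
  rw [mem_closedBall, dist_comm, dist_zero_right, not_le]
  exact h

/-- The image datum `(c/s, ρ/s)`, `s = ‖c‖² - ρ²`, again satisfies `ρ/s < ‖c/s‖` when `0 ≤ ρ < ‖c‖`.
[folklore] -/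
theorem div_lt_norm_smul_of_lt_norm {c : V} {ρ : ℝ} (hρ : 0 ≤ ρ) (h : ρ < ‖c‖) :
    ρ / (‖c‖ ^ 2 - ρ ^ 2) < ‖(‖c‖ ^ 2 - ρ ^ 2)⁻¹ • c‖ := by
  have hs := sub_sq_pos_of_lt_norm hρ h
  rw [norm_smul, Real.norm_eq_abs, abs_inv, abs_of_pos hs, ← div_eq_inv_mul]
  exact div_lt_div_of_pos_right h hs

/-- **Inversion and closed balls off the origin**: for `0 ≤ ρ < ‖c‖` and `s = ‖c‖² - ρ²`,
`x/‖x‖² ∈ B̄(c/s, ρ/s) ↔ x ∈ B̄(c, ρ)` for every `x`. [folklore] -/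
theorem inversion_mem_closedBall_iff {c : V} {ρ : ℝ} (hρ : 0 ≤ ρ) (h : ρ < ‖c‖) (x : V) :
    inversion (0:V) 1 x ∈ closedBall ((‖c‖ ^ 2 - ρ ^ 2)⁻¹ • c) (ρ / (‖c‖ ^ 2 - ρ ^ 2)) ↔
      x ∈ closedBall c ρ := by
  have hs := sub_sq_pos_of_lt_norm hρ h
  have hρ' : 0 ≤ ρ / (‖c‖ ^ 2 - ρ ^ 2) := div_nonneg hρ hs.le
  by_cases hx : x = 0
  · subst hx
    rw [inversion_self]
    constructor
    · intro h0
      exact absurd h0 (zero_notMem_closedBall_of_lt_norm (div_lt_norm_smul_of_lt_norm hρ h))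
    · intro h0
      exact absurd h0 (zero_notMem_closedBall_of_lt_norm h)
  · have key := norm_inversion_sub_sq_sub x c ρ hx hs.ne'
    have hx2 : 0 < ‖x‖ ^ 2 := by positivity
    rw [mem_closedBall, mem_closedBall, dist_eq_norm, dist_eq_norm,
      ← sq_le_sq₀ (norm_nonneg _) hρ', ← sub_nonpos, key, ← sq_le_sq₀ (norm_nonneg _) hρ,
      div_nonpos_iff]
    constructor
    · rintro (⟨h1, h2⟩ | ⟨h1, h2⟩)
      · have : (‖c‖ ^ 2 - ρ ^ 2) * ‖x‖ ^ 2 = 0 := le_antisymm h2 (by positivity)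
        exact absurd this (by positivity)
      · linarith
    · intro hle
      exact Or.inr ⟨by linarith, by positivity⟩

/-- The same for open balls: `x/‖x‖² ∈ B(c/s, ρ/s) ↔ x ∈ B(c, ρ)` (`0 ≤ ρ < ‖c‖`, `s = ‖c‖² - ρ²`).
[folklore] -/
theorem inversion_mem_ball_iff {c : V} {ρ : ℝ} (hρ : 0 ≤ ρ) (h : ρ < ‖c‖) (x : V) :
    inversion (0:V) 1 x ∈ ball ((‖c‖ ^ 2 - ρ ^ 2)⁻¹ • c) (ρ / (‖c‖ ^ 2 - ρ ^ 2)) ↔ x ∈ ball c ρ := by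
  have hs := sub_sq_pos_of_lt_norm hρ h
  have hρ' : 0 ≤ ρ / (‖c‖ ^ 2 - ρ ^ 2) := div_nonneg hρ hs.le
  by_cases hx : x = 0
  · subst hx
    rw [inversion_self]
    constructor
    · intro h0
      exact absurd (ball_subset_closedBall h0)
        (zero_notMem_closedBall_of_lt_norm (div_lt_norm_smul_of_lt_norm hρ h))
    · intro h0
      exact absurd (ball_subset_closedBall h0) (zero_notMem_closedBall_of_lt_norm h)
  · have key := norm_inversion_sub_sq_sub x c ρ hx hs.ne'
    have hx2 : 0 < ‖x‖ ^ 2 := by positivity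
    rw [mem_ball, mem_ball, dist_eq_norm, dist_eq_norm,
      ← sq_lt_sq₀ (norm_nonneg _) hρ', ← sub_neg, key, ← sq_lt_sq₀ (norm_nonneg _) hρ,
      div_neg_iff]
    constructor
    · rintro (⟨h1, h2⟩ | ⟨h1, h2⟩)
      · exact absurd h2 (not_lt.2 (by positivity))
      · linarith
    · intro hlt
      exact Or.inr ⟨by linarith, by positivity⟩

/-- Hence the image of the closed ball: `inv '' B̄(c, ρ) = B̄(c/s, ρ/s)`. [folklore] -/
theorem image_inversion_closedBall {c : V} {ρ : ℝ} (hρ : 0 ≤ ρ) (h : ρ < ‖c‖) :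
    inversion (0:V) 1 '' closedBall c ρ = closedBall ((‖c‖ ^ 2 - ρ ^ 2)⁻¹ • c) (ρ / (‖c‖ ^ 2 - ρ ^ 2)) := by
  ext y
  constructor
  · rintro ⟨x, hx, rfl⟩
    exact (inversion_mem_closedBall_iff hρ h x).2 hx
  · intro hy
    refine ⟨inversion (0:V) 1 y, ?_, inversion_inversion 0 one_ne_zero y⟩
    rw [← inversion_mem_closedBall_iff hρ h, inversion_inversion 0 one_ne_zero]
    exact hy

/-- And of the open ball: `inv '' B(c, ρ) = B(c/s, ρ/s)`. [folklore] -/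
theorem image_inversion_ball {c : V} {ρ : ℝ} (hρ : 0 ≤ ρ) (h : ρ < ‖c‖) :
    inversion (0:V) 1 '' ball c ρ = ball ((‖c‖ ^ 2 - ρ ^ 2)⁻¹ • c) (ρ / (‖c‖ ^ 2 - ρ ^ 2)) := by
  ext y
  constructor
  · rintro ⟨x, hx, rfl⟩
    exact (inversion_mem_ball_iff hρ h x).2 hx
  · intro hy
    refine ⟨inversion (0:V) 1 y, ?_, inversion_inversion 0 one_ne_zero y⟩
    rw [← inversion_mem_ball_iff hρ h, inversion_inversion 0 one_ne_zero]
    exact hy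

/-- Disjoint closed balls away from the origin have disjoint inverted images. [folklore] -/
theorem disjoint_closedBall_inversion {c₁ c₂ : V} {ρ₁ ρ₂ : ℝ} (h₁ : 0 ≤ ρ₁) (h₁' : ρ₁ < ‖c₁‖)
    (h₂ : 0 ≤ ρ₂) (h₂' : ρ₂ < ‖c₂‖) (hd : Disjoint (closedBall c₁ ρ₁) (closedBall c₂ ρ₂)) :
    Disjoint (closedBall ((‖c₁‖ ^ 2 - ρ₁ ^ 2)⁻¹ • c₁) (ρ₁ / (‖c₁‖ ^ 2 - ρ₁ ^ 2)))
      (closedBall ((‖c₂‖ ^ 2 - ρ₂ ^ 2)⁻¹ • c₂) (ρ₂ / (‖c₂‖ ^ 2 - ρ₂ ^ 2))) := by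
  rw [← image_inversion_closedBall h₁ h₁', ← image_inversion_closedBall h₂ h₂']
  exact hd.image (inversion_injective (0:V) one_ne_zero).injOn (Set.subset_univ _) (Set.subset_univ _)

/-! ### The image of a point's neighbourhood: off-centring estimates -/

/-- `x/‖x‖² - t x = (‖x‖⁻² - t) x`. [folklore] -/
theorem inversion_sub_smul_self (z : V) (t : ℝ) :
    inversion (0:V) 1 z - t • z = ((‖z‖ ^ 2)⁻¹ - t) • z := by
  rw [inversion_zero_one_eq, sub_smul]

/-- Distance from `z/‖z‖²` to the centre `z/(‖z‖² - η²)` of the image of the ball `B̄(z, η)`: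
`η²/((‖z‖² - η²)‖z‖)` — second order in `η`. [folklore] -/
theorem dist_inversion_smul_self {z : V} (hz : z ≠ 0) {η : ℝ} (hη : η ^ 2 < ‖z‖ ^ 2) :
    dist (inversion (0:V) 1 z) ((‖z‖ ^ 2 - η ^ 2)⁻¹ • z) = η ^ 2 / ((‖z‖ ^ 2 - η ^ 2) * ‖z‖) := by
  have hN : 0 < ‖z‖ := norm_pos_iff.2 hz
  have hs : 0 < ‖z‖ ^ 2 - η ^ 2 := by linarith
  rw [dist_eq_norm, inversion_sub_smul_self, norm_smul, Real.norm_eq_abs]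
  have : (‖z‖ ^ 2)⁻¹ - (‖z‖ ^ 2 - η ^ 2)⁻¹ = -(η ^ 2 / ((‖z‖ ^ 2 - η ^ 2) * ‖z‖ ^ 2)) := by
    field_simp
    ring
  rw [this, abs_neg, abs_of_nonneg (by positivity)]
  field_simp

/-- The inverted point lies in the image ball: for `0 < r < ‖z‖`,
`z/‖z‖² ∈ B(z/(‖z‖² - r²), r/(‖z‖² - r²))`. [folklore] -/
theorem inversion_mem_ball_image {z : V} {r : ℝ} (hr : 0 < r) (h : r < ‖z‖) :
    inversion (0:V) 1 z ∈ ball ((‖z‖ ^ 2 - r ^ 2)⁻¹ • z) (r / (‖z‖ ^ 2 - r ^ 2)) :=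
  (inversion_mem_ball_iff hr.le h z).2 (mem_ball_self hr)

/-- … and well inside the image of a SMALL ball: for `0 < η < ‖z‖/2`,
`z/‖z‖² ∈ B(z/(‖z‖² - η²), (η/(‖z‖² - η²))/2)` (the off-centring is `O(η²)`). [folklore] -/
theorem inversion_mem_ball_image_half {z : V} {η : ℝ} (hη : 0 < η) (h : η < ‖z‖ / 2) :
    inversion (0:V) 1 z ∈ ball ((‖z‖ ^ 2 - η ^ 2)⁻¹ • z) (η / (‖z‖ ^ 2 - η ^ 2) / 2) := by
  have hN : 0 < ‖z‖ := by linarith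
  have hz : z ≠ 0 := norm_pos_iff.1 hN
  have hη2 : η ^ 2 < ‖z‖ ^ 2 := by nlinarith
  have hs : 0 < ‖z‖ ^ 2 - η ^ 2 := by linarith
  rw [mem_ball, dist_inversion_smul_self hz hη2, div_div, div_lt_div_iff₀ (by positivity) (by positivity)]
  nlinarith [mul_pos hs hη, mul_pos (mul_pos hs hη) hN]

/-- **Sandwich, outer side.** For `0 < ε ≤ 1`, `z ≠ 0` and `0 < η ≤ ε‖z‖/8`, the ball of radius `η/‖z‖²`
about `z/‖z‖²` is contained in the image `B(z/(‖z‖²-η₊²), η₊/(‖z‖²-η₊²))` of the ball `B(z, η₊)`,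
`η₊ = η(1+ε)`. [folklore] -/
theorem ball_inversion_subset_image {z : V} (hz : z ≠ 0) {ε η : ℝ} (hε : 0 < ε) (hε1 : ε ≤ 1)
    (hη : 0 < η) (hη0 : η ≤ ε * ‖z‖ / 8) :
    ball (inversion (0:V) 1 z) (η / ‖z‖ ^ 2) ⊆
      ball ((‖z‖ ^ 2 - (η * (1 + ε)) ^ 2)⁻¹ • z) (η * (1 + ε) / (‖z‖ ^ 2 - (η * (1 + ε)) ^ 2)) := by
  have hN : 0 < ‖z‖ := norm_pos_iff.2 hz
  set t := η * (1 + ε) with ht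
  have ht0 : 0 < t := by positivity
  have ht2η : t ≤ 2 * η := by rw [ht]; nlinarith
  have htN : t ≤ ‖z‖ / 4 := by nlinarith
  have ht2 : t ^ 2 < ‖z‖ ^ 2 := by nlinarith
  have hs : 0 < ‖z‖ ^ 2 - t ^ 2 := by linarith
  refine ball_subset_ball' ?_
  rw [dist_inversion_smul_self hz ht2, div_add_div _ _ (by positivity) (by positivity),
    div_le_div_iff₀ (by positivity) hs]
  -- reduced form: `η (N² - t²) + N t² ≤ t N²`, i.e. `N t² - η t² ≤ N² (t - η) = N² η ε`
  have hred : η * (‖z‖ ^ 2 - t ^ 2) + ‖z‖ * t ^ 2 ≤ t * ‖z‖ ^ 2 := by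
    have h1 : ‖z‖ * t ^ 2 ≤ ‖z‖ * (4 * η ^ 2) := by
      apply mul_le_mul_of_nonneg_left _ hN.le; nlinarith
    have h2 : t * ‖z‖ ^ 2 - η * ‖z‖ ^ 2 = ‖z‖ ^ 2 * (η * ε) := by rw [ht]; ring
    have h3 : ‖z‖ * (4 * η ^ 2) ≤ ‖z‖ ^ 2 * (η * ε) := by nlinarith [mul_pos hN hη]
    nlinarith [mul_nonneg hη.le (sq_nonneg t)]
  calc (η * ((‖z‖ ^ 2 - t ^ 2) * ‖z‖) + ‖z‖ ^ 2 * t ^ 2) * (‖z‖ ^ 2 - t ^ 2)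
      = (η * (‖z‖ ^ 2 - t ^ 2) + ‖z‖ * t ^ 2) * (‖z‖ * (‖z‖ ^ 2 - t ^ 2)) := by ring
    _ ≤ (t * ‖z‖ ^ 2) * (‖z‖ * (‖z‖ ^ 2 - t ^ 2)) :=
        mul_le_mul_of_nonneg_right hred (by positivity)
    _ = t * (‖z‖ ^ 2 * ((‖z‖ ^ 2 - t ^ 2) * ‖z‖)) := by ring

/-- **Sandwich, inner side.** For `0 < ε < 1`, `z ≠ 0` and `0 < η ≤ ε‖z‖/8`, the image
`B(z/(‖z‖²-η₋²), η₋/(‖z‖²-η₋²))` of the ball `B(z, η₋)`, `η₋ = η(1-ε)`, is contained in the ball of radius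
`η/‖z‖²` about `z/‖z‖²`. [folklore] -/
theorem image_subset_ball_inversion {z : V} (hz : z ≠ 0) {ε η : ℝ} (hε : 0 < ε) (hε1 : ε < 1)
    (hη : 0 < η) (hη0 : η ≤ ε * ‖z‖ / 8) :
    ball ((‖z‖ ^ 2 - (η * (1 - ε)) ^ 2)⁻¹ • z) (η * (1 - ε) / (‖z‖ ^ 2 - (η * (1 - ε)) ^ 2)) ⊆
      ball (inversion (0:V) 1 z) (η / ‖z‖ ^ 2) := by
  have hN : 0 < ‖z‖ := norm_pos_iff.2 hz
  set t := η * (1 - ε) with ht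
  have ht0 : 0 < t := by rw [ht]; exact mul_pos hη (by linarith)
  have htη : t ≤ η := by rw [ht]; nlinarith
  have hηN : η ≤ ‖z‖ / 8 := by nlinarith
  have ht2 : t ^ 2 < ‖z‖ ^ 2 := by nlinarith
  have hs : 0 < ‖z‖ ^ 2 - t ^ 2 := by linarith
  refine ball_subset_ball' ?_
  rw [dist_comm, dist_inversion_smul_self hz ht2, div_add_div _ _ hs.ne' (by positivity),
    div_le_div_iff₀ (by positivity) (by positivity)]
  -- reduced form: `N (t N + t²) ≤ η (N² - t²)`, i.e. `t² N + η t² ≤ N² (η - t) = N² η ε`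
  have hred : ‖z‖ * (t * ‖z‖ + t ^ 2) ≤ η * (‖z‖ ^ 2 - t ^ 2) := by
    have h2 : η * ‖z‖ ^ 2 - t * ‖z‖ ^ 2 = ‖z‖ ^ 2 * (η * ε) := by rw [ht]; ring
    have h3 : ‖z‖ * t ^ 2 + η * t ^ 2 ≤ ‖z‖ * η ^ 2 + η * η ^ 2 := by
      have : t ^ 2 ≤ η ^ 2 := by nlinarith
      nlinarith
    have h4 : ‖z‖ * η ^ 2 + η * η ^ 2 ≤ ‖z‖ ^ 2 * (η * ε) := by
      -- `η N + η² ≤ ε N²` from `η ≤ ε N / 8` and `ε ≤ 1`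
      have h5 : η * ‖z‖ ≤ ε * ‖z‖ ^ 2 / 8 := by nlinarith
      have h6 : η ^ 2 ≤ ε * ‖z‖ ^ 2 / 64 := by nlinarith
      nlinarith
    nlinarith
  calc (t * ((‖z‖ ^ 2 - t ^ 2) * ‖z‖) + (‖z‖ ^ 2 - t ^ 2) * t ^ 2) * ‖z‖ ^ 2
      = (‖z‖ * (t * ‖z‖ + t ^ 2)) * (‖z‖ * (‖z‖ ^ 2 - t ^ 2)) := by ring
    _ ≤ (η * (‖z‖ ^ 2 - t ^ 2)) * (‖z‖ * (‖z‖ ^ 2 - t ^ 2)) :=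
        mul_le_mul_of_nonneg_right hred (by positivity)
    _ = η * ((‖z‖ ^ 2 - t ^ 2) * ((‖z‖ ^ 2 - t ^ 2) * ‖z‖)) := by ring

end Literature.Geometry.Euclidean

end
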